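import Summits.AtomisticToContinuum.HydrodynamicLimit.Theorems.AntiMazurCoboundariesCellForecastPressureDecayClusterTailCharging
import Summits.AtomisticToContinuum.HydrodynamicLimit.Theorems.AntiMazurCoboundariesCellForecastPressureDecayClusterTailInsertion
import Literature.Analysis.FluidPDE.BoltzmannEquationProofs
import HarnessLib

/-!
# S2e-3(B) · the short-time cluster tail, T1 piece 2: the static double-cylinder integral of a tagged pair
# (sub-goal `stub_clusterTail_freshPairHit_static` of the registered sub-goal `stub_clusterTail_freshPairHit`
# of stub `stub_clusterTail`, crux line `enskog-compensator-martingale`, crux `CellForecastPressureDecay`,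
# stmt-AtomisticToContinuum-13915)

The static half of the T1 estimate (a fresh pair disturbed by the bath is a second-order event). The pathwise
piece (`stub_clusterTail_freshPairHit_pathwise`) bounds the event by a measurable majorant of the initial data of
the tagged pair `(y₁, w₁), (y₂, w₂)` and of the bath: the indicator that `(y₁ − y₂, w₁ − w₂)` lies in the collision
cylinder of the slab, times the number of triples (grid time, bath sphere, tag) whose EXPLICIT two-body state of
the tag at the grid time, relative to the bath sphere, lies in the cylinder of one mesh length `h`. Here this
majorant is integrated over the two tagged POSITIONS, uniform on the cube `[0, L]³`:

* `measurable_twoBodyMajorant` — the majorant is jointly measurable in all its arguments;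
* `lintegral_lintegral_cond_cellCube_le` — `∫∫ H(y₁, y₂) dν dν ≤ L⁻⁶ ∫dq ∫dy₁ H(y₁, y₁ − q)` (domination of
  the uniform law by `L⁻³ ×` Lebesgue measure, translation invariance, Tonelli);
* `lintegral_twoBodyMajorant_section_le` — for fixed relative position `q` each tagged position is a TRANSLATE
  of `y₁`, so each charging indicator integrates in `y₁` to `≤ σ² h ‖w' − V‖ |S²|` (piece S2e(B)), and
  `‖w'‖ ≤ ‖w₁‖ + ‖w₂‖` by conservation of the two-body kinetic energy;
* the remaining cylinder indicator integrates in `q` to `≤ σ² Δ ‖w₁ − w₂‖ |S²|` (`volume_cylRel_section_le`);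
* `stub_clusterTail_freshPairHit_static` — the registered form.

References: Cercignani–Illner–Pulvirenti 1994, §2.2 (collision cylinders); Gallagher–Saint-Raymond–Texier 2013,
§4.1.
-/

noncomputable section

open MeasureTheory ProbabilityTheory Set Filter Topology
open scoped ENNReal BigOperators InnerProductSpace
open Literature.Analysis.FluidPDE Literature.MathematicalPhysics.KineticTheory
open Summit.AtomisticToContinuum.HydrodynamicLimit.Theorems.CellForecastPressureDecay
  (cellCube measurableSet_cellCube volume_cellCube)

namespace Summit.AtomisticToContinuum.HydrodynamicLimit.Theorems.EnskogCompensator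

/-! ## Measurability of the two-body data -/

section Measurability

/-- The first hitting time of the free pair is a measurable function of (relative position, relative velocity).
[folklore] -/
theorem measurable_pairHitTime_prod (σ : ℝ) : Measurable fun p : V3 × V3 => pairHitTime σ p.1 p.2 := by
  have hinner : Continuous fun p : V3 × V3 => ⟪p.1, p.2⟫_ℝ := continuous_inner
  have hdisc : Continuous fun p : V3 × V3 => pairDisc σ p.1 p.2 := by
    unfold pairDisc; fun_prop
  unfold pairHitTime
  exact ((hinner.neg.sub hdisc.sqrt).measurable).div (by fun_prop)

/-- The elastic reflection law is a measurable function of (impact vector, velocities). [folklore] -/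
theorem measurable_reflectVel_prod : Measurable fun p : V3 × (V3 × V3) => reflectVel p.1 p.2 := by
  have hc : Measurable fun p : V3 × (V3 × V3) => ⟪p.2.1 - p.2.2, p.1⟫_ℝ / ‖p.1‖ ^ 2 :=
    (by fun_prop : Continuous fun p : V3 × (V3 × V3) => ⟪p.2.1 - p.2.2, p.1⟫_ℝ).measurable.div
      (by fun_prop : Continuous fun p : V3 × (V3 × V3) => ‖p.1‖ ^ 2).measurable
  unfold reflectVel
  exact (measurable_snd.fst.sub (hc.smul measurable_fst)).prodMk (measurable_snd.snd.add (hc.smul measurable_fst))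

/-- **The two-body majorant is jointly measurable.** For measurable bath maps `B ℓ : β → Cell m`, the function
of `x = (((y₁, w₁), (y₂, w₂)), b)` given by the cylinder indicator of `(y₁ − y₂, w₁ − w₂)` times the number of
triples (grid index `ℓ < M`, bath label `c`, tag) whose explicit two-body state of the tag at the grid time `a ℓ` —
position `y + τ w + (a ℓ − τ) w'`, velocity `w'`, `τ = pairHitTime σ q u`, `(w₁', w₂') = reflectVel (q + τ u) (w₁, w₂)`,
`q = y₁ − y₂`, `u = w₁ − w₂` — relative to the bath sphere `B ℓ b c` lies in the cylinder of length `h`, is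
measurable. [folklore] -/
theorem measurable_twoBodyMajorant {β : Type*} [MeasurableSpace β] (σ Δ h : ℝ) (a : ℕ → ℝ) (M m : ℕ)
    {B : ℕ → β → Cell m} (hB : ∀ ℓ, Measurable (B ℓ)) :
    Measurable fun x : ((V3 × V3) × (V3 × V3)) × β =>
      {p : V3 × V3 | PairHits σ p.1 p.2 ∧ 0 < pairDisc σ p.1 p.2 ∧ pairHitTime σ p.1 p.2 ∈ Set.Ioc 0 Δ}.indicator (1
            : V3 × V3 → ℝ≥0∞) ((x.1.1.1 - x.1.2.1), (x.1.1.2 - x.1.2.2)) * ∑ ℓ ∈ Finset.range M, ∑ c : Fin m, ({p :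
            V3 × V3 | PairHits σ p.1 p.2 ∧ 0 < pairDisc σ p.1 p.2 ∧ pairHitTime σ p.1 p.2 ∈ Set.Ioc 0 h}.indicator (1
            : V3 × V3 → ℝ≥0∞) (x.1.1.1 + pairHitTime σ (x.1.1.1 - x.1.2.1) (x.1.1.2 - x.1.2.2) • x.1.1.2 + (a ℓ -
            pairHitTime σ (x.1.1.1 - x.1.2.1) (x.1.1.2 - x.1.2.2)) • (reflectVel ((x.1.1.1 - x.1.2.1) + pairHitTime σ
            (x.1.1.1 - x.1.2.1) (x.1.1.2 - x.1.2.2) • (x.1.1.2 - x.1.2.2)) (x.1.1.2, x.1.2.2)).1 - (B ℓ x.2 c).1,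
            (reflectVel ((x.1.1.1 - x.1.2.1) + pairHitTime σ (x.1.1.1 - x.1.2.1) (x.1.1.2 - x.1.2.2) • (x.1.1.2 -
            x.1.2.2)) (x.1.1.2, x.1.2.2)).1 - (B ℓ x.2 c).2) + {p : V3 × V3 | PairHits σ p.1 p.2 ∧ 0 < pairDisc σ p.1
            p.2 ∧ pairHitTime σ p.1 p.2 ∈ Set.Ioc 0 h}.indicator (1 : V3 × V3 → ℝ≥0∞) (x.1.2.1 + pairHitTime σ
            (x.1.1.1 - x.1.2.1) (x.1.1.2 - x.1.2.2) • x.1.2.2 + (a ℓ - pairHitTime σ (x.1.1.1 - x.1.2.1) (x.1.1.2 -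
            x.1.2.2)) • (reflectVel ((x.1.1.1 - x.1.2.1) + pairHitTime σ (x.1.1.1 - x.1.2.1) (x.1.1.2 - x.1.2.2) •
            (x.1.1.2 - x.1.2.2)) (x.1.1.2, x.1.2.2)).2 - (B ℓ x.2 c).1, (reflectVel ((x.1.1.1 - x.1.2.1) +
            pairHitTime σ (x.1.1.1 - x.1.2.1) (x.1.1.2 - x.1.2.2) • (x.1.1.2 - x.1.2.2)) (x.1.1.2, x.1.2.2)).2 - (B ℓ
            x.2 c).2)) := by
  -- the building blocks (composites are elaborated without expected type, then checked by `rfl`-conversion)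
  have hy₁ : Measurable fun x : ((V3 × V3) × (V3 × V3)) × β => x.1.1.1 := measurable_fst.fst.fst
  have hw₁ : Measurable fun x : ((V3 × V3) × (V3 × V3)) × β => x.1.1.2 := measurable_fst.fst.snd
  have hy₂ : Measurable fun x : ((V3 × V3) × (V3 × V3)) × β => x.1.2.1 := measurable_fst.snd.fst
  have hw₂ : Measurable fun x : ((V3 × V3) × (V3 × V3)) × β => x.1.2.2 := measurable_fst.snd.snd
  have hq : Measurable fun x : ((V3 × V3) × (V3 × V3)) × β => x.1.1.1 - x.1.2.1 := hy₁.sub hy₂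
  have hu : Measurable fun x : ((V3 × V3) × (V3 × V3)) × β => x.1.1.2 - x.1.2.2 := hw₁.sub hw₂
  have hτ : Measurable fun x : ((V3 × V3) × (V3 × V3)) × β => pairHitTime σ (x.1.1.1 - x.1.2.1) (x.1.1.2 - x.1.2.2) :=
    ((measurable_pairHitTime_prod σ).comp (hq.prodMk hu) :)
  have hW : Measurable fun x : ((V3 × V3) × (V3 × V3)) × β => reflectVel ((x.1.1.1 - x.1.2.1) + pairHitTime σ
        (x.1.1.1 - x.1.2.1) (x.1.1.2 - x.1.2.2) • (x.1.1.2 - x.1.2.2)) (x.1.1.2, x.1.2.2) :=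
    (measurable_reflectVel_prod.comp ((hq.add (hτ.smul hu)).prodMk (hw₁.prodMk hw₂)) :)
  have hBx : ∀ ℓ c, Measurable fun x : ((V3 × V3) × (V3 × V3)) × β => B ℓ x.2 c :=
    fun ℓ c => ((measurable_pi_apply c).comp ((hB ℓ).comp measurable_snd) :)
  -- top-down assembly (only pattern unifications)
  refine Measurable.mul ?_ (Finset.measurable_sum _ fun ℓ _ => Finset.measurable_sum _ fun c _ => ?_)
  · exact (measurable_one.indicator (measurableSet_cylRel σ Δ)).comp (hq.prodMk hu)
  refine Measurable.add ?_ ?_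
  · refine (measurable_one.indicator (measurableSet_cylRel σ h)).comp (Measurable.prodMk ?_ ?_)
    · exact ((hy₁.add (hτ.smul hw₁)).add ((measurable_const.sub hτ).smul hW.fst)).sub (hBx ℓ c).fst
    · exact hW.fst.sub (hBx ℓ c).snd
  · refine (measurable_one.indicator (measurableSet_cylRel σ h)).comp (Measurable.prodMk ?_ ?_)
    · exact ((hy₂.add (hτ.smul hw₂)).add ((measurable_const.sub hτ).smul hW.snd)).sub (hBx ℓ c).fst
    · exact hW.snd.sub (hBx ℓ c).snd

end Measurability

/-! ## Translation invariance: the uniform law of two tagged positions -/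

section Translation

/-- **Two uniform positions, in relative coordinates.** For measurable `H ≥ 0` and `L > 0`,
`∫∫ H(y₁, y₂) dν(y₁) dν(y₂) ≤ L⁻³ · L⁻³ · ∫ dq ∫ dy₁ H(y₁, y₁ − q)` with `ν` the uniform law on `[0, L]³`
(domination `ν ≤ L⁻³ dy`, the substitution `y₂ = y₁ − q`, Tonelli). [folklore] -/
theorem lintegral_lintegral_cond_cellCube_le {L : ℝ} (hL : 0 < L) {H : V3 → V3 → ℝ≥0∞}
    (hH : Measurable fun p : V3 × V3 => H p.1 p.2) :
    ∫⁻ y₂, ∫⁻ y₁, H y₁ y₂ ∂(volume[|cellCube L]) ∂(volume[|cellCube L]) ≤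
      ENNReal.ofReal ((L ^ 3)⁻¹) * ENNReal.ofReal ((L ^ 3)⁻¹) * ∫⁻ q, ∫⁻ y₁, H y₁ (y₁ - q) := by
  have h1 : ∫⁻ y₂, ∫⁻ y₁, H y₁ y₂ ∂(volume[|cellCube L]) ∂(volume[|cellCube L]) ≤
      ENNReal.ofReal ((L ^ 3)⁻¹) * ENNReal.ofReal ((L ^ 3)⁻¹) * ∫⁻ y₂, ∫⁻ y₁, H y₁ y₂ := by
    calc ∫⁻ y₂, ∫⁻ y₁, H y₁ y₂ ∂(volume[|cellCube L]) ∂(volume[|cellCube L])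
        ≤ ∫⁻ y₂, ENNReal.ofReal ((L ^ 3)⁻¹) * (∫⁻ y₁, H y₁ y₂) ∂(volume[|cellCube L]) :=
          lintegral_mono fun y₂ => lintegral_cond_cellCube_le_pow hL _
      _ = ENNReal.ofReal ((L ^ 3)⁻¹) * ∫⁻ y₂, (∫⁻ y₁, H y₁ y₂) ∂(volume[|cellCube L]) :=
          lintegral_const_mul' _ _ ENNReal.ofReal_ne_top
      _ ≤ ENNReal.ofReal ((L ^ 3)⁻¹) * (ENNReal.ofReal ((L ^ 3)⁻¹) * ∫⁻ y₂, ∫⁻ y₁, H y₁ y₂) :=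
          mul_le_mul' le_rfl (lintegral_cond_cellCube_le_pow hL _)
      _ = _ := by rw [mul_assoc]
  refine h1.trans (le_of_eq ?_)
  congr 1
  -- swap, substitute `y₂ = y₁ - q`, swap back
  have hsw : Measurable (Function.uncurry fun y₂ y₁ : V3 => H y₁ y₂) := hH.comp measurable_swap
  have hsw' : Measurable (Function.uncurry fun y₁ q : V3 => H y₁ (y₁ - q)) :=
    hH.comp (measurable_fst.prodMk (measurable_fst.sub measurable_snd))
  rw [lintegral_lintegral_swap hsw.aemeasurable]
  rw [show (∫⁻ y₁, ∫⁻ y₂, H y₁ y₂) = ∫⁻ y₁, ∫⁻ q, H y₁ (y₁ - q) from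
    lintegral_congr fun y₁ => (lintegral_sub_left_eq_self (μ := (volume : Measure V3)) (H y₁) y₁).symm]
  rw [lintegral_lintegral_swap hsw'.aemeasurable]

/-- **A translated section of the cylinder**: `∫ 1_{Cyl_h}(y + e, u) dy ≤ σ² h ‖u‖ |S²|`. [cite: CIP1994, §2.2] -/
theorem lintegral_indicator_cylRel_add_le {σ : ℝ} (hσ : 0 < σ) (h : ℝ) (e u : V3) :
    ∫⁻ y : V3, {p : V3 × V3 | PairHits σ p.1 p.2 ∧ 0 < pairDisc σ p.1 p.2 ∧ pairHitTime σ p.1 p.2 ∈ Set.Ioc 0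
          h}.indicator (1 : V3 × V3 → ℝ≥0∞) (y + e, u) ≤
      ENNReal.ofReal (σ ^ 2 * h * ‖u‖) * sphereMeasure (Set.univ : Set (Metric.sphere (0 : V3) 1)) := by
  have := lintegral_indicator_cylRel_sub_le hσ h u (-e)
  simpa only [sub_neg_eq_add] using this

/-- The charging indicator of an affine image of the integration variable is measurable. [folklore] -/
theorem measurable_indicator_cylRel_comp (σ h : ℝ) {f : V3 → V3} (hf : Measurable f) (u : V3) :
    Measurable fun y : V3 => {p : V3 × V3 | PairHits σ p.1 p.2 ∧ 0 < pairDisc σ p.1 p.2 ∧ pairHitTime σ p.1 p.2 ∈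
          Set.Ioc 0 h}.indicator (1 : V3 × V3 → ℝ≥0∞) (f y, u) :=
  (measurable_one.indicator (measurableSet_cylRel σ h)).comp (hf.prodMk measurable_const)

/-- **The static core.** If for every relative position `q` the `y₁`-integral of `H(y₁, y₁ − q)` is at most
`1_{Cyl_Δ}(q, u) · K`, then `∫∫ H dν dν ≤ L⁻⁶ · σ² Δ ‖u‖ |S²| · K`. [cite: CIP1994, §2.2] -/
theorem lintegral_lintegral_cond_cellCube_le_of_section {σ L Δ : ℝ} (hσ : 0 < σ) (hL : 0 < L)
    {H : V3 → V3 → ℝ≥0∞} (hH : Measurable fun p : V3 × V3 => H p.1 p.2) {u : V3} {K : ℝ≥0∞}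
    (hsec : ∀ q, ∫⁻ y₁, H y₁ (y₁ - q) ≤ {p : V3 × V3 | PairHits σ p.1 p.2 ∧ 0 < pairDisc σ p.1 p.2 ∧ pairHitTime σ
          p.1 p.2 ∈ Set.Ioc 0 Δ}.indicator (1 : V3 × V3 → ℝ≥0∞) (q, u) * K) :
    ∫⁻ y₂, ∫⁻ y₁, H y₁ y₂ ∂(volume[|cellCube L]) ∂(volume[|cellCube L]) ≤
      ENNReal.ofReal ((L ^ 3)⁻¹) * ENNReal.ofReal ((L ^ 3)⁻¹) *
        (ENNReal.ofReal (σ ^ 2 * Δ * ‖u‖) * sphereMeasure (Set.univ : Set (Metric.sphere (0 : V3) 1)) * K) := by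
  refine (lintegral_lintegral_cond_cellCube_le hL hH).trans (mul_le_mul' le_rfl ?_)
  have hind : Measurable fun q : V3 => {p : V3 × V3 | PairHits σ p.1 p.2 ∧ 0 < pairDisc σ p.1 p.2 ∧ pairHitTime σ p.1
        p.2 ∈ Set.Ioc 0 Δ}.indicator (1 : V3 × V3 → ℝ≥0∞) (q, u) :=
    measurable_indicator_cylRel_comp σ Δ measurable_id u
  calc ∫⁻ q, ∫⁻ y₁, H y₁ (y₁ - q) ≤ ∫⁻ q, {p : V3 × V3 | PairHits σ p.1 p.2 ∧ 0 < pairDisc σ p.1 p.2 ∧ pairHitTime σ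
        p.1 p.2 ∈ Set.Ioc 0 Δ}.indicator (1 : V3 × V3 → ℝ≥0∞) (q, u) * K :=
        lintegral_mono hsec
    _ = (∫⁻ q, {p : V3 × V3 | PairHits σ p.1 p.2 ∧ 0 < pairDisc σ p.1 p.2 ∧ pairHitTime σ p.1 p.2 ∈ Set.Ioc 0
          Δ}.indicator (1 : V3 × V3 → ℝ≥0∞) (q, u)) * K := lintegral_mul_const K hind
    _ ≤ _ := mul_le_mul' ?_ le_rfl
  have hmeas : MeasurableSet {q : V3 | PairHits σ q u ∧ 0 < pairDisc σ q u ∧ pairHitTime σ q u ∈ Set.Ioc 0 Δ} :=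
    (measurableSet_cylRel σ Δ).preimage (by fun_prop : Measurable fun y : V3 => (y, u))
  calc ∫⁻ q, {p : V3 × V3 | PairHits σ p.1 p.2 ∧ 0 < pairDisc σ p.1 p.2 ∧ pairHitTime σ p.1 p.2 ∈ Set.Ioc 0
        Δ}.indicator (1 : V3 × V3 → ℝ≥0∞) (q, u)
      = ∫⁻ q, {q : V3 | PairHits σ q u ∧ 0 < pairDisc σ q u ∧ pairHitTime σ q u ∈ Set.Ioc 0 Δ}.indicator 1 q := by
        refine lintegral_congr fun q => ?_
        by_cases hq : PairHits σ q u ∧ 0 < pairDisc σ q u ∧ pairHitTime σ q u ∈ Set.Ioc 0 Δ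
        · rw [Set.indicator_of_mem (show (q, u) ∈ {p : V3 × V3 | PairHits σ p.1 p.2 ∧ 0 < pairDisc σ p.1 p.2 ∧
              pairHitTime σ p.1 p.2 ∈ Set.Ioc 0 Δ} from hq),
            Set.indicator_of_mem (show q ∈ {q : V3 | PairHits σ q u ∧ 0 < pairDisc σ q u ∧
              pairHitTime σ q u ∈ Set.Ioc 0 Δ} from hq)]
          rfl
        · rw [Set.indicator_of_notMem (show (q, u) ∉ {p : V3 × V3 | PairHits σ p.1 p.2 ∧ 0 < pairDisc σ p.1 p.2 ∧
              pairHitTime σ p.1 p.2 ∈ Set.Ioc 0 Δ} from hq),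
            Set.indicator_of_notMem (show q ∉ {q : V3 | PairHits σ q u ∧ 0 < pairDisc σ q u ∧
              pairHitTime σ q u ∈ Set.Ioc 0 Δ} from hq)]
    _ = volume {q : V3 | PairHits σ q u ∧ 0 < pairDisc σ q u ∧ pairHitTime σ q u ∈ Set.Ioc 0 Δ} :=
        lintegral_indicator_one hmeas
    _ ≤ _ := volume_cylRel_section_le hσ Δ u

end Translation

section TwoBodyEnergy

/-- `‖w₁'‖, ‖w₂'‖ ≤ ‖w₁‖ + ‖w₂‖` for the reflected velocities (conservation of the two-body kinetic energy).
[cite: CIP1994, §4.2] -/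
theorem norm_reflectVel_le (n v w : V3) :
    ‖(reflectVel n (v, w)).1‖ ≤ ‖v‖ + ‖w‖ ∧ ‖(reflectVel n (v, w)).2‖ ≤ ‖v‖ + ‖w‖ := by
  have h := norm_sq_reflectVel_fst_add_norm_sq_reflectVel_snd n (v, w)
  have h1 : ‖(reflectVel n (v, w)).1‖ ^ 2 ≤ (‖v‖ + ‖w‖) ^ 2 := by
    nlinarith [sq_nonneg ‖(reflectVel n (v, w)).2‖, norm_nonneg v, norm_nonneg w]
  have h2 : ‖(reflectVel n (v, w)).2‖ ^ 2 ≤ (‖v‖ + ‖w‖) ^ 2 := by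
    nlinarith [sq_nonneg ‖(reflectVel n (v, w)).1‖, norm_nonneg v, norm_nonneg w]
  exact ⟨(pow_le_pow_iff_left₀ (norm_nonneg _) (by positivity) two_ne_zero).1 h1,
    (pow_le_pow_iff_left₀ (norm_nonneg _) (by positivity) two_ne_zero).1 h2⟩

/-- `‖w' − V‖ ≤ ‖w₁‖ + ‖w₂‖ + ‖V‖` for either reflected velocity `w'`. [folklore] -/
theorem norm_reflectVel_sub_le (n v w V : V3) :
    ‖(reflectVel n (v, w)).1 - V‖ ≤ ‖v‖ + ‖w‖ + ‖V‖ ∧ ‖(reflectVel n (v, w)).2 - V‖ ≤ ‖v‖ + ‖w‖ + ‖V‖ :=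
  ⟨(norm_sub_le _ _).trans (by linarith [(norm_reflectVel_le n v w).1]),
    (norm_sub_le _ _).trans (by linarith [(norm_reflectVel_le n v w).2])⟩

end TwoBodyEnergy

/-! ## The position integrals of the two-body majorant -/

section Static

variable {σ : ℝ} {m : ℕ}

/-- **The `y₁`-section at fixed relative position.** For fixed `q = y₁ − y₂` the two-body data `τ`, `w'` are
constant and each tagged position is a translate of `y₁`, so the `y₁`-integral of the majorant is at most
`1_{Cyl_Δ}(q, w₁ − w₂) · ∑_{ℓ,c} 2 σ² h (‖w₁‖ + ‖w₂‖ + ‖V_{ℓ,c}‖) |S²|`. [cite: CIP1994, §2.2] -/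
theorem lintegral_twoBodyMajorant_section_le (hσ : 0 < σ) {h : ℝ} (hh : 0 ≤ h) (Δ : ℝ) (M : ℕ) (a : ℕ → ℝ)
    (X V : ℕ → Fin m → V3) (w₁ w₂ q : V3) :
    ∫⁻ y₁, {p : V3 × V3 | PairHits σ p.1 p.2 ∧ 0 < pairDisc σ p.1 p.2 ∧ pairHitTime σ p.1 p.2 ∈ Set.Ioc 0
          Δ}.indicator (1 : V3 × V3 → ℝ≥0∞) ((y₁ - (y₁ - q)), (w₁ - w₂)) * ∑ ℓ ∈ Finset.range M, ∑ c : Fin m, ({p :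
          V3 × V3 | PairHits σ p.1 p.2 ∧ 0 < pairDisc σ p.1 p.2 ∧ pairHitTime σ p.1 p.2 ∈ Set.Ioc 0 h}.indicator (1 :
          V3 × V3 → ℝ≥0∞) (y₁ + pairHitTime σ (y₁ - (y₁ - q)) (w₁ - w₂) • w₁ + (a ℓ - pairHitTime σ (y₁ - (y₁ - q))
          (w₁ - w₂)) • (reflectVel ((y₁ - (y₁ - q)) + pairHitTime σ (y₁ - (y₁ - q)) (w₁ - w₂) • (w₁ - w₂)) (w₁,
          w₂)).1 - X ℓ c, (reflectVel ((y₁ - (y₁ - q)) + pairHitTime σ (y₁ - (y₁ - q)) (w₁ - w₂) • (w₁ - w₂)) (w₁,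
          w₂)).1 - V ℓ c) + {p : V3 × V3 | PairHits σ p.1 p.2 ∧ 0 < pairDisc σ p.1 p.2 ∧ pairHitTime σ p.1 p.2 ∈
          Set.Ioc 0 h}.indicator (1 : V3 × V3 → ℝ≥0∞) ((y₁ - q) + pairHitTime σ (y₁ - (y₁ - q)) (w₁ - w₂) • w₂ + (a ℓ
          - pairHitTime σ (y₁ - (y₁ - q)) (w₁ - w₂)) • (reflectVel ((y₁ - (y₁ - q)) + pairHitTime σ (y₁ - (y₁ - q))
          (w₁ - w₂) • (w₁ - w₂)) (w₁, w₂)).2 - X ℓ c, (reflectVel ((y₁ - (y₁ - q)) + pairHitTime σ (y₁ - (y₁ - q))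
          (w₁ - w₂) • (w₁ - w₂)) (w₁, w₂)).2 - V ℓ c)) ≤
      {p : V3 × V3 | PairHits σ p.1 p.2 ∧ 0 < pairDisc σ p.1 p.2 ∧ pairHitTime σ p.1 p.2 ∈ Set.Ioc 0 Δ}.indicator (1
            : V3 × V3 → ℝ≥0∞) (q, w₁ - w₂) *
        ∑ ℓ ∈ Finset.range M, ∑ c : Fin m, 2 * (ENNReal.ofReal (σ ^ 2 * h * (‖w₁‖ + ‖w₂‖ + ‖V ℓ c‖)) * sphereMeasure
              (Set.univ : Set (Metric.sphere (0 : V3) 1))) := by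
  simp only [sub_sub_cancel]
  set τ : ℝ := pairHitTime σ q (w₁ - w₂) with hτdef
  set W : V3 × V3 := reflectVel (q + τ • (w₁ - w₂)) (w₁, w₂) with hWdef
  -- the two charging indicators, as functions of the grid index, the bath label and `y₁`
  set F₁ : ℕ → Fin m → V3 → ℝ≥0∞ := fun ℓ c y₁ =>
    {p : V3 × V3 | PairHits σ p.1 p.2 ∧ 0 < pairDisc σ p.1 p.2 ∧ pairHitTime σ p.1 p.2 ∈ Set.Ioc 0 h}.indicator (1 :
          V3 × V3 → ℝ≥0∞) (y₁ + τ • w₁ + (a ℓ - τ) • W.1 - X ℓ c, W.1 - V ℓ c) with hF₁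
  set F₂ : ℕ → Fin m → V3 → ℝ≥0∞ := fun ℓ c y₁ =>
    {p : V3 × V3 | PairHits σ p.1 p.2 ∧ 0 < pairDisc σ p.1 p.2 ∧ pairHitTime σ p.1 p.2 ∈ Set.Ioc 0 h}.indicator (1 :
          V3 × V3 → ℝ≥0∞) (y₁ - q + τ • w₂ + (a ℓ - τ) • W.2 - X ℓ c, W.2 - V ℓ c) with hF₂
  change ∫⁻ y₁, _ * ∑ ℓ ∈ Finset.range M, ∑ c : Fin m, (F₁ ℓ c y₁ + F₂ ℓ c y₁) ≤ _
  have hm₁ : ∀ ℓ c, Measurable (F₁ ℓ c) := fun ℓ c => measurable_indicator_cylRel_comp σ h (by fun_prop) _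
  have hm₂ : ∀ ℓ c, Measurable (F₂ ℓ c) := fun ℓ c => measurable_indicator_cylRel_comp σ h (by fun_prop) _
  have hm₁₂ : ∀ ℓ c, Measurable fun y₁ => F₁ ℓ c y₁ + F₂ ℓ c y₁ := fun ℓ c => (hm₁ ℓ c).add (hm₂ ℓ c)
  have hmc : ∀ ℓ, Measurable fun y₁ => ∑ c : Fin m, (F₁ ℓ c y₁ + F₂ ℓ c y₁) :=
    fun ℓ => Finset.measurable_sum _ fun c _ => hm₁₂ ℓ c
  rw [lintegral_const_mul _ (Finset.measurable_sum _ fun ℓ _ => hmc ℓ)]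
  refine mul_le_mul' le_rfl ?_
  rw [lintegral_finsetSum _ fun ℓ _ => hmc ℓ]
  refine Finset.sum_le_sum fun ℓ _ => ?_
  rw [lintegral_finsetSum _ fun c _ => hm₁₂ ℓ c]
  refine Finset.sum_le_sum fun c _ => ?_
  rw [lintegral_add_left (hm₁ ℓ c), two_mul]
  have hσh : 0 ≤ σ ^ 2 * h := by positivity
  have hP₁ : ∀ y₁ : V3, y₁ + τ • w₁ + (a ℓ - τ) • W.1 - X ℓ c = y₁ + (τ • w₁ + (a ℓ - τ) • W.1 - X ℓ c) :=
    fun y₁ => by abel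
  have hP₂ : ∀ y₁ : V3, y₁ - q + τ • w₂ + (a ℓ - τ) • W.2 - X ℓ c = y₁ + (τ • w₂ + (a ℓ - τ) • W.2 - X ℓ c - q) :=
    fun y₁ => by abel
  simp only [hF₁, hF₂, hP₁, hP₂]
  refine add_le_add ?_ ?_
  · refine (lintegral_indicator_cylRel_add_le hσ h _ _).trans (mul_le_mul' (ENNReal.ofReal_le_ofReal ?_) le_rfl)
    exact mul_le_mul_of_nonneg_left (norm_reflectVel_sub_le _ _ _ _).1 hσh
  · refine (lintegral_indicator_cylRel_add_le hσ h _ _).trans (mul_le_mul' (ENNReal.ofReal_le_ofReal ?_) le_rfl)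
    exact mul_le_mul_of_nonneg_left (norm_reflectVel_sub_le _ _ _ _).2 hσh

/-- The two-body majorant with fixed tagged velocities and bath data is jointly measurable in the two tagged
positions. [folklore] -/
theorem measurable_twoBodyMajorant_pos (σ Δ h : ℝ) (a : ℕ → ℝ) (M : ℕ) (X V : ℕ → Fin m → V3) (w₁ w₂ : V3) :
    Measurable fun p : V3 × V3 =>
      {p : V3 × V3 | PairHits σ p.1 p.2 ∧ 0 < pairDisc σ p.1 p.2 ∧ pairHitTime σ p.1 p.2 ∈ Set.Ioc 0 Δ}.indicator (1
            : V3 × V3 → ℝ≥0∞) ((p.1 - p.2), (w₁ - w₂)) * ∑ ℓ ∈ Finset.range M, ∑ c : Fin m, ({p : V3 × V3 | PairHits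
            σ p.1 p.2 ∧ 0 < pairDisc σ p.1 p.2 ∧ pairHitTime σ p.1 p.2 ∈ Set.Ioc 0 h}.indicator (1 : V3 × V3 → ℝ≥0∞)
            (p.1 + pairHitTime σ (p.1 - p.2) (w₁ - w₂) • w₁ + (a ℓ - pairHitTime σ (p.1 - p.2) (w₁ - w₂)) •
            (reflectVel ((p.1 - p.2) + pairHitTime σ (p.1 - p.2) (w₁ - w₂) • (w₁ - w₂)) (w₁, w₂)).1 - X ℓ c,
            (reflectVel ((p.1 - p.2) + pairHitTime σ (p.1 - p.2) (w₁ - w₂) • (w₁ - w₂)) (w₁, w₂)).1 - V ℓ c) + {p :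
            V3 × V3 | PairHits σ p.1 p.2 ∧ 0 < pairDisc σ p.1 p.2 ∧ pairHitTime σ p.1 p.2 ∈ Set.Ioc 0 h}.indicator (1
            : V3 × V3 → ℝ≥0∞) (p.2 + pairHitTime σ (p.1 - p.2) (w₁ - w₂) • w₂ + (a ℓ - pairHitTime σ (p.1 - p.2) (w₁
            - w₂)) • (reflectVel ((p.1 - p.2) + pairHitTime σ (p.1 - p.2) (w₁ - w₂) • (w₁ - w₂)) (w₁, w₂)).2 - X ℓ c,
            (reflectVel ((p.1 - p.2) + pairHitTime σ (p.1 - p.2) (w₁ - w₂) • (w₁ - w₂)) (w₁, w₂)).2 - V ℓ c)) := by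
  have hB : ∀ ℓ : ℕ, Measurable (fun _ : Unit => (fun c : Fin m => (X ℓ c, V ℓ c) : Cell m)) :=
    fun ℓ => measurable_const
  have hπ : Measurable fun p : V3 × V3 => ((((p.1, w₁), (p.2, w₂)) : (V3 × V3) × (V3 × V3)), ()) := by fun_prop
  exact ((measurable_twoBodyMajorant σ Δ h a M m hB).comp hπ :)

/-- **The double position integral of the two-body majorant** (extended-real form):
`∫∫ (majorant) dν(y₁) dν(y₂) ≤ L⁻³ · L⁻³ · (σ² Δ ‖w₁ − w₂‖ |S²| · ∑_{ℓ,c} 2 σ² h (‖w₁‖ + ‖w₂‖ + ‖V_{ℓ,c}‖) |S²|)`.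
[cite: CIP1994, §2.2] -/
theorem lintegral_lintegral_twoBodyMajorant_le (hσ : 0 < σ) {L : ℝ} (hL : 0 < L) {h : ℝ} (hh : 0 ≤ h) (Δ : ℝ)
    (M : ℕ) (a : ℕ → ℝ) (X V : ℕ → Fin m → V3) (w₁ w₂ : V3) :
    ∫⁻ y₂, ∫⁻ y₁, {p : V3 × V3 | PairHits σ p.1 p.2 ∧ 0 < pairDisc σ p.1 p.2 ∧ pairHitTime σ p.1 p.2 ∈ Set.Ioc 0
          Δ}.indicator (1 : V3 × V3 → ℝ≥0∞) ((y₁ - y₂), (w₁ - w₂)) * ∑ ℓ ∈ Finset.range M, ∑ c : Fin m, ({p : V3 × V3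
          | PairHits σ p.1 p.2 ∧ 0 < pairDisc σ p.1 p.2 ∧ pairHitTime σ p.1 p.2 ∈ Set.Ioc 0 h}.indicator (1 : V3 × V3
          → ℝ≥0∞) (y₁ + pairHitTime σ (y₁ - y₂) (w₁ - w₂) • w₁ + (a ℓ - pairHitTime σ (y₁ - y₂) (w₁ - w₂)) •
          (reflectVel ((y₁ - y₂) + pairHitTime σ (y₁ - y₂) (w₁ - w₂) • (w₁ - w₂)) (w₁, w₂)).1 - X ℓ c, (reflectVel
          ((y₁ - y₂) + pairHitTime σ (y₁ - y₂) (w₁ - w₂) • (w₁ - w₂)) (w₁, w₂)).1 - V ℓ c) + {p : V3 × V3 | PairHits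
          σ p.1 p.2 ∧ 0 < pairDisc σ p.1 p.2 ∧ pairHitTime σ p.1 p.2 ∈ Set.Ioc 0 h}.indicator (1 : V3 × V3 → ℝ≥0∞)
          (y₂ + pairHitTime σ (y₁ - y₂) (w₁ - w₂) • w₂ + (a ℓ - pairHitTime σ (y₁ - y₂) (w₁ - w₂)) • (reflectVel ((y₁
          - y₂) + pairHitTime σ (y₁ - y₂) (w₁ - w₂) • (w₁ - w₂)) (w₁, w₂)).2 - X ℓ c, (reflectVel ((y₁ - y₂) +
          pairHitTime σ (y₁ - y₂) (w₁ - w₂) • (w₁ - w₂)) (w₁, w₂)).2 - V ℓ c)) ∂(volume[|cellCube L])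
          ∂(volume[|cellCube L]) ≤
      ENNReal.ofReal ((L ^ 3)⁻¹) * ENNReal.ofReal ((L ^ 3)⁻¹) *
        (ENNReal.ofReal (σ ^ 2 * Δ * ‖w₁ - w₂‖) * sphereMeasure (Set.univ : Set (Metric.sphere (0 : V3) 1)) *
          ∑ ℓ ∈ Finset.range M, ∑ c : Fin m, 2 * (ENNReal.ofReal (σ ^ 2 * h * (‖w₁‖ + ‖w₂‖ + ‖V ℓ c‖)) *
                sphereMeasure (Set.univ : Set (Metric.sphere (0 : V3) 1)))) :=
  lintegral_lintegral_cond_cellCube_le_of_section hσ hL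
    (H := fun y₁ y₂ => {p : V3 × V3 | PairHits σ p.1 p.2 ∧ 0 < pairDisc σ p.1 p.2 ∧ pairHitTime σ p.1 p.2 ∈ Set.Ioc 0
          Δ}.indicator (1 : V3 × V3 → ℝ≥0∞) ((y₁ - y₂), (w₁ - w₂)) * ∑ ℓ ∈ Finset.range M, ∑ c : Fin m, ({p : V3 × V3
          | PairHits σ p.1 p.2 ∧ 0 < pairDisc σ p.1 p.2 ∧ pairHitTime σ p.1 p.2 ∈ Set.Ioc 0 h}.indicator (1 : V3 × V3
          → ℝ≥0∞) (y₁ + pairHitTime σ (y₁ - y₂) (w₁ - w₂) • w₁ + (a ℓ - pairHitTime σ (y₁ - y₂) (w₁ - w₂)) •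
          (reflectVel ((y₁ - y₂) + pairHitTime σ (y₁ - y₂) (w₁ - w₂) • (w₁ - w₂)) (w₁, w₂)).1 - X ℓ c, (reflectVel
          ((y₁ - y₂) + pairHitTime σ (y₁ - y₂) (w₁ - w₂) • (w₁ - w₂)) (w₁, w₂)).1 - V ℓ c) + {p : V3 × V3 | PairHits
          σ p.1 p.2 ∧ 0 < pairDisc σ p.1 p.2 ∧ pairHitTime σ p.1 p.2 ∈ Set.Ioc 0 h}.indicator (1 : V3 × V3 → ℝ≥0∞)
          (y₂ + pairHitTime σ (y₁ - y₂) (w₁ - w₂) • w₂ + (a ℓ - pairHitTime σ (y₁ - y₂) (w₁ - w₂)) • (reflectVel ((y₁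
          - y₂) + pairHitTime σ (y₁ - y₂) (w₁ - w₂) • (w₁ - w₂)) (w₁, w₂)).2 - X ℓ c, (reflectVel ((y₁ - y₂) +
          pairHitTime σ (y₁ - y₂) (w₁ - w₂) • (w₁ - w₂)) (w₁, w₂)).2 - V ℓ c)))
    (measurable_twoBodyMajorant_pos σ Δ h a M X V w₁ w₂)
    (fun q => lintegral_twoBodyMajorant_section_le hσ hh Δ M a X V w₁ w₂ q)

end Static

/-! ## The registered sub-goal -/

/-- **Registered sub-goal `stub_clusterTail_freshPairHit_static`** (piece of the registered sub-goal
`stub_clusterTail_freshPairHit`, S2e-3, of stub `stub_clusterTail` of the line `enskog-compensator-martingale`):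
**the static double-cylinder integral of a tagged pair.** For `σ > 0`, `L > 0`, `Δ, h ≥ 0`, grid times `a ℓ`, bath
data `(X_{ℓ,c}, V_{ℓ,c})` and tagged velocities `w₁, w₂`, the integral over two independent uniform positions
`y₁, y₂ ∈ [0, L]³` of the two-body majorant — the indicator that `(y₁ − y₂, w₁ − w₂)` lies in the collision cylinder of
length `Δ`, times the number of triples (grid index `ℓ < M`, bath label `c`, tag) whose explicit two-body state of the
tag at time `a ℓ` relative to `(X_{ℓ,c}, V_{ℓ,c})` lies in the cylinder of length `h` — is at most
`L⁻⁶ · σ² Δ (‖w₁‖ + ‖w₂‖) |S²| · ∑_{ℓ < M} ∑_c 2 σ² h (‖w₁‖ + ‖w₂‖ + ‖V_{ℓ,c}‖) |S²|`: one factor of the mesh from the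
charging cylinder (translation invariance of the tagged positions), one factor `Δ` from the pair's own cylinder.
[cite: CIP1994, §2.2] -/
theorem stub_clusterTail_freshPairHit_static : ∀ (σ L Δ h : ℝ) (M m : ℕ) (a : ℕ → ℝ) (X V : ℕ → Fin m → V3) (w₁ w₂ :
      V3),
    0 < σ → 0 < L → 0 ≤ Δ → 0 ≤ h →
    ∫⁻ y₂, ∫⁻ y₁,
        {p : V3 × V3 | PairHits σ p.1 p.2 ∧ 0 < pairDisc σ p.1 p.2 ∧ pairHitTime σ p.1 p.2 ∈ Set.Ioc 0 Δ}.indicator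
              (1 : V3 × V3 → ℝ≥0∞) ((y₁ - y₂), (w₁ - w₂)) * ∑ ℓ ∈ Finset.range M, ∑ c : Fin m, ({p : V3 × V3 |
              PairHits σ p.1 p.2 ∧ 0 < pairDisc σ p.1 p.2 ∧ pairHitTime σ p.1 p.2 ∈ Set.Ioc 0 h}.indicator (1 : V3 ×
              V3 → ℝ≥0∞) (y₁ + pairHitTime σ (y₁ - y₂) (w₁ - w₂) • w₁ + (a ℓ - pairHitTime σ (y₁ - y₂) (w₁ - w₂)) •
              (reflectVel ((y₁ - y₂) + pairHitTime σ (y₁ - y₂) (w₁ - w₂) • (w₁ - w₂)) (w₁, w₂)).1 - X ℓ c,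
              (reflectVel ((y₁ - y₂) + pairHitTime σ (y₁ - y₂) (w₁ - w₂) • (w₁ - w₂)) (w₁, w₂)).1 - V ℓ c) + {p : V3
              × V3 | PairHits σ p.1 p.2 ∧ 0 < pairDisc σ p.1 p.2 ∧ pairHitTime σ p.1 p.2 ∈ Set.Ioc 0 h}.indicator (1
              : V3 × V3 → ℝ≥0∞) (y₂ + pairHitTime σ (y₁ - y₂) (w₁ - w₂) • w₂ + (a ℓ - pairHitTime σ (y₁ - y₂) (w₁ -
              w₂)) • (reflectVel ((y₁ - y₂) + pairHitTime σ (y₁ - y₂) (w₁ - w₂) • (w₁ - w₂)) (w₁, w₂)).2 - X ℓ c,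
              (reflectVel ((y₁ - y₂) + pairHitTime σ (y₁ - y₂) (w₁ - w₂) • (w₁ - w₂)) (w₁, w₂)).2 - V ℓ c))
      ∂(ProbabilityTheory.cond volume {y : V3 | ∀ k, y k ∈ Set.Icc (0 : ℝ) L})
      ∂(ProbabilityTheory.cond volume {y : V3 | ∀ k, y k ∈ Set.Icc (0 : ℝ) L}) ≤
    ENNReal.ofReal ((L ^ 3)⁻¹ * (L ^ 3)⁻¹ * (σ ^ 2 * Δ * (‖w₁‖ + ‖w₂‖) * (sphereMeasure (Set.univ : Set
          (Metric.sphere (0 : V3) 1))).toReal *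
      ∑ ℓ ∈ Finset.range M, ∑ c : Fin m, 2 * (σ ^ 2 * h * (‖w₁‖ + ‖w₂‖ + ‖V ℓ c‖) * (sphereMeasure (Set.univ : Set
            (Metric.sphere (0 : V3) 1))).toReal))) := by
  intro σ L Δ h M m a X V w₁ w₂ hσ hL hΔ hh
  haveI : IsFiniteMeasure (sphereMeasure : Measure (Metric.sphere (0 : V3) 1)) := isFiniteMeasure_sphereMeasure
  have hS : sphereMeasure (Set.univ : Set (Metric.sphere (0 : V3) 1)) ≠ ⊤ := measure_ne_top _ _
  refine (lintegral_lintegral_twoBodyMajorant_le hσ hL hh Δ M a X V w₁ w₂).trans ?_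
  -- replace `‖w₁ - w₂‖` by `‖w₁‖ + ‖w₂‖`
  refine (mul_le_mul' le_rfl (mul_le_mul' (mul_le_mul' (ENNReal.ofReal_le_ofReal
    (mul_le_mul_of_nonneg_left (norm_sub_le w₁ w₂) (by positivity))) le_rfl) le_rfl)).trans (le_of_eq ?_)
  -- convert to a single `ofReal`
  rw [ENNReal.ofReal_mul (by positivity : 0 ≤ (L ^ 3)⁻¹ * (L ^ 3)⁻¹), ENNReal.ofReal_mul (by positivity : 0 ≤ (L ^
        3)⁻¹),
    ENNReal.ofReal_mul (by positivity : 0 ≤ σ ^ 2 * Δ * (‖w₁‖ + ‖w₂‖) * (sphereMeasure (Set.univ : Set (Metric.sphere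
          (0 : V3) 1))).toReal),
    ENNReal.ofReal_mul (by positivity : 0 ≤ σ ^ 2 * Δ * (‖w₁‖ + ‖w₂‖)), ENNReal.ofReal_toReal hS,
    ENNReal.ofReal_sum_of_nonneg (s := Finset.range M)
      (f := fun ℓ => ∑ c : Fin m, 2 * (σ ^ 2 * h * (‖w₁‖ + ‖w₂‖ + ‖V ℓ c‖) * (sphereMeasure (Set.univ : Set
            (Metric.sphere (0 : V3) 1))).toReal))
      (fun ℓ _ => Finset.sum_nonneg fun c _ => by positivity)]
  congr 2
  refine Finset.sum_congr rfl fun ℓ _ => ?_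
  rw [ENNReal.ofReal_sum_of_nonneg (s := (Finset.univ : Finset (Fin m)))
    (f := fun c => 2 * (σ ^ 2 * h * (‖w₁‖ + ‖w₂‖ + ‖V ℓ c‖) * (sphereMeasure (Set.univ : Set (Metric.sphere (0 : V3)
          1))).toReal)) (fun c _ => by positivity)]
  refine Finset.sum_congr rfl fun c _ => ?_
  rw [ENNReal.ofReal_mul zero_le_two, ENNReal.ofReal_ofNat,
    ENNReal.ofReal_mul (by positivity : 0 ≤ σ ^ 2 * h * (‖w₁‖ + ‖w₂‖ + ‖V ℓ c‖)), ENNReal.ofReal_toReal hS]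

end Summit.AtomisticToContinuum.HydrodynamicLimit.Theorems.EnskogCompensator

end
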